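import Mathlib
import Summits.Ventures.PercRepro.TriangleCapThreeTable
import Summits.Ventures.PercRepro.TriangleCapBroom
import Summits.Ventures.PercRepro.TriangleCapTriangleFreeTableAttained
import Summits.Ventures.PercRepro.TriangleCapTFamilyGen
import Summits.Ventures.PercRepro.TriangleCapSecondBestParity
import Summits.Ventures.PercRepro.TriangleCapThreeBelowSecondBest

/-!
# PercRepro — THE THIRD-BEST VALUE OF THE `K₄⁻`-FREE CHERRY TABLE: `closed − 2 (r − 1)` on every cell `r ≥ 3` of
every row `a ≥ 3` — the star plus a disjoint missing pair (p3, gen 50; part 208)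

On the cell `(k, a, r)` (`K₄⁻`-free graphs on `Fin k` with `a (k − a) − r` edges) the values of `Σ_v d(v)²` are the
closed form `m k − r (k − 1 − r)` (the missing pairs a star, gens 40–42), then `closed − 2 (r − 2)` (the brooms and
the `4`-cycle, `cherry_second_best_ge_three`), and — since the closed form is even and every graph's `Σ d²` is even
(`closed_form_parity_gap`'s parity, here `closed_form_parity_step`) — every other graph is at most
`closed − 2 (r − 2) − 2 = closed − 2 (r − 1)`.  The value IS attained: `K_{a,k−a}` minus an `(r − 1)`-star at the
vertex `0` of the small side minus one more pair `{1, k − 1}` DISJOINT from the star (`starPlusPair`, one edge deleted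
from `bipMinusStar k a (r − 1)`; `Σ d²` drops by `2 (d(1) + d(k − 1)) − 2 = 2 k − 2`).

* `closed_form_parity_step` — `Σ d² + r (k − 1 − r) + 2 X + 1 ≤ m k` ⇒ `… + 2 X + 2 ≤ m k` (parity);
* `starPlusPair`, `starPlusPair_value` — the witness and its three counts;
* **`cherry_third_best`** — on every cell `r ≥ 3`, `a ≥ 3`, `2 a + r ≤ k` (`r + 7 ≤ k` on the row `a = 3`): a graph
  neither at the closed form nor at the second-best value is `≥ 2 (r − 1)` below, and the value is attained;
  cherry form `cherry_third_best_cherries`.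

Axioms: standard.
-/

namespace PercRepro

namespace TriangleCap

namespace C047

open Finset

variable {V : Type*} [Fintype V] [DecidableEq V]

omit [DecidableEq V] in
/-- **THE PARITY STEP:** on a cell `m + r = a (k − a)` (`1 ≤ a`, `2 a + r ≤ k`) the closed form `m k − r (k − 1 − r)`
is even, and so is `Σ_v d(v)²`; hence `Σ d² + r (k − 1 − r) + 2 X + 1 ≤ m k` forces `… + 2 X + 2 ≤ m k`. -/
theorem closed_form_parity_step (D : SimpleGraph V) [DecidableRel D.Adj] (a r X : ℕ) (ha : 1 ≤ a)
    (hk : 2 * a + r ≤ Fintype.card V) (hm : D.edgeFinset.card + r = a * (Fintype.card V - a))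
    (h : ∑ v, deg D v * deg D v + r * (Fintype.card V - 1 - r) + 2 * X + 1 ≤
      D.edgeFinset.card * Fintype.card V) :
    ∑ v, deg D v * deg D v + r * (Fintype.card V - 1 - r) + 2 * X + 2 ≤
      D.edgeFinset.card * Fintype.card V := by
  obtain ⟨p, hp⟩ := even_sum_deg_sq D
  obtain ⟨q, hq⟩ : Even (D.edgeFinset.card * Fintype.card V + r * Fintype.card V) := by
    have h1 := even_mul_sub_mul a (Fintype.card V) (by omega)
    have h2 : D.edgeFinset.card * Fintype.card V + r * Fintype.card V =
        a * (Fintype.card V - a) * Fintype.card V := by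
      rw [← add_mul, hm]
    rw [h2]
    exact h1
  obtain ⟨s, hs⟩ : Even (r * r + r) := by
    have : r * r + r = r * (r + 1) := by ring
    rw [this]
    exact Nat.even_mul_succ_self r
  have ht := closed_form_term_arith (Fintype.card V) r (by omega)
  omega

/-- **THE STAR PLUS A DISJOINT PAIR** on `Fin n`: `K_{a,n−a}` minus an `(r − 1)`-star at the vertex `0` of the small
side (`bipMinusStar n a (r − 1)`, leaves `a, …, a + r − 2`) minus the pair `{1, n − 1}`, disjoint from the star. -/
abbrev starPlusPair (n a r : ℕ) (h1 : 1 < n) : SimpleGraph (Fin n) :=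
  delEdge (bipMinusStar n a (r - 1)) ⟨1, h1⟩ ⟨n - 1, by omega⟩

/-- The arithmetic of the witness: `S₀ + (r − 1)(k − 1 − (r − 1)) = (E + 1) k` and `S + 2 k = S₀ + 2` give
`S + r (k − 1 − r) + 2 (r − 1) = E k`. -/
theorem starPlusPair_arith (k r E S S₀ : ℕ) (hr : 1 ≤ r) (hk : r + 1 ≤ k)
    (hS0 : S₀ + (r - 1) * (k - 1 - (r - 1)) = (E + 1) * k) (hS : S + 2 * k = S₀ + 2) :
    S + r * (k - 1 - r) + 2 * (r - 1) = E * k := by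
  obtain ⟨r', rfl⟩ : ∃ r', r = r' + 1 := ⟨r - 1, by omega⟩
  obtain ⟨t, rfl⟩ : ∃ t, k = r' + 2 + t := ⟨k - (r' + 2), by omega⟩
  have e1 : r' + 1 - 1 = r' := by omega
  have e2 : r' + 2 + t - 1 - r' = t + 1 := by omega
  have e3 : r' + 2 + t - 1 - (r' + 1) = t := by omega
  rw [e1, e2] at hS0
  rw [e1, e3]
  linarith

/-- **THE WITNESS ATTAINS `closed − 2 (r − 1)`:** for `2 ≤ a`, `1 ≤ r`, `a + r ≤ n`, the star plus a disjoint pair is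
`K₄⁻`-free, has `a (n − a) − r` edges and `Σ_v d(v)² + r (n − 1 − r) + 2 (r − 1) = m n`. -/
theorem starPlusPair_value (n a r : ℕ) (ha2 : 2 ≤ a) (hr : 1 ≤ r) (han : a + r ≤ n) :
    K4mFree (starPlusPair n a r (by omega)) ∧
      (starPlusPair n a r (by omega)).edgeFinset.card + r = a * (n - a) ∧
      ∑ v, deg (starPlusPair n a r (by omega)) v * deg (starPlusPair n a r (by omega)) v + r * (n - 1 - r) +
          2 * (r - 1) = (starPlusPair n a r (by omega)).edgeFinset.card * n := by
  have h1 : 1 < n := by omega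
  have hadj := bipMinusStar_adj_one_last_row n a (r - 1) ha2 (by omega)
  refine ⟨?_, ?_, ?_⟩
  · exact k4mFree_of_le _ _ (delEdge_le _ _ _) (k4mFree_bipMinusStar n a (r - 1))
  · have h2 := card_edges_delEdge (bipMinusStar n a (r - 1)) hadj
    have h3 := card_edges_bipMinusStar n a (r - 1) (by omega) (by omega)
    show (delEdge (bipMinusStar n a (r - 1)) ⟨1, h1⟩ ⟨n - 1, by omega⟩).edgeFinset.card + r = a * (n - a)
    omega
  · have h2 := sum_deg_sq_delEdge (bipMinusStar n a (r - 1)) hadj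
    have h3 := sum_deg_sq_bipMinusStar n a (r - 1) (by omega) (by omega) (by omega)
    have hE := card_edges_delEdge (bipMinusStar n a (r - 1)) hadj
    rw [Fintype.card_fin] at h3
    rw [deg_bipMinusStar_one_row n a (r - 1) ha2 (by omega),
      deg_bipMinusStar_last_row n a (r - 1) ha2 (by omega)] at h2
    have e : n - a + a = n := by omega
    rw [e] at h2
    rw [← hE] at h3
    exact starPlusPair_arith n r _ _ _ hr (by omega) h3 h2

/-- **THE THIRD-BEST VALUE OF THE CHERRY TABLE** on every cell `(k, a, r)` with `3 ≤ a`, `3 ≤ r`, `2 a + r ≤ k`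
(`r + 7 ≤ k` on the row `a = 3`): every `K₄⁻`-free graph with `a (k − a) − r` edges whose `Σ_v d(v)²` is neither the
closed form `m k − r (k − 1 − r)` nor the second-best value `closed − 2 (r − 2)` satisfies
`Σ_v d(v)² + r (k − 1 − r) + 2 (r − 1) ≤ m k`, and the value `closed − 2 (r − 1)` is attained (the star plus a
disjoint pair). -/
theorem cherry_third_best (k a r : ℕ) (ha3 : 3 ≤ a) (hr3 : 3 ≤ r) (hk : 2 * a + r ≤ k)
    (hk3 : a = 3 → r + 7 ≤ k) :
    (∀ (D : SimpleGraph (Fin k)) [DecidableRel D.Adj], K4mFree D → D.edgeFinset.card + r = a * (k - a) →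
        ∑ v, deg D v * deg D v + r * (k - 1 - r) ≠ D.edgeFinset.card * k →
        ∑ v, deg D v * deg D v + r * (k - 1 - r) + 2 * (r - 2) ≠ D.edgeFinset.card * k →
        ∑ v, deg D v * deg D v + r * (k - 1 - r) + 2 * (r - 1) ≤ D.edgeFinset.card * k) ∧
      ∃ (D : SimpleGraph (Fin k)) (_ : DecidableRel D.Adj), K4mFree D ∧ D.edgeFinset.card + r = a * (k - a) ∧
        ∑ v, deg D v * deg D v + r * (k - 1 - r) + 2 * (r - 1) = D.edgeFinset.card * k := by
  have hcard : Fintype.card (Fin k) = k := Fintype.card_fin k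
  refine ⟨?_, ?_⟩
  · intro D _ hK hm hne1 hne2
    have h2 := (cherry_second_best_ge_three k a r ha3 hr3 hk hk3).1 D hK hm hne1
    have h3 : ∑ v, deg D v * deg D v + r * (k - 1 - r) + 2 * (r - 2) + 1 ≤ D.edgeFinset.card * k := by
      omega
    have h4 := closed_form_parity_step D a r (r - 2) (by omega) (by rw [hcard]; exact hk)
      (by rw [hcard]; exact hm) (by rw [hcard]; exact h3)
    rw [hcard] at h4
    omega
  · obtain ⟨hK, hE, hS⟩ := starPlusPair_value k a r (by omega) (by omega) (by omega)
    exact ⟨starPlusPair k a r (by omega), inferInstance, hK, hE, hS⟩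

/-- **THE THIRD-BEST VALUE OF THE CHERRY TABLE, CHERRY FORM:** `2 · cherries + r (k − 1 − r)` neither `m (k − 2)` nor
`m (k − 2) − 2 (r − 2)` forces `2 · cherries + r (k − 1 − r) + 2 (r − 1) ≤ m (k − 2)`; attained. -/
theorem cherry_third_best_cherries (k a r : ℕ) (ha3 : 3 ≤ a) (hr3 : 3 ≤ r) (hk : 2 * a + r ≤ k)
    (hk3 : a = 3 → r + 7 ≤ k) :
    (∀ (D : SimpleGraph (Fin k)) [DecidableRel D.Adj], K4mFree D → D.edgeFinset.card + r = a * (k - a) →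
        2 * cherries D + r * (k - 1 - r) ≠ D.edgeFinset.card * (k - 2) →
        2 * cherries D + r * (k - 1 - r) + 2 * (r - 2) ≠ D.edgeFinset.card * (k - 2) →
        2 * cherries D + r * (k - 1 - r) + 2 * (r - 1) ≤ D.edgeFinset.card * (k - 2)) ∧
      ∃ (D : SimpleGraph (Fin k)) (_ : DecidableRel D.Adj), K4mFree D ∧ D.edgeFinset.card + r = a * (k - a) ∧
        2 * cherries D + r * (k - 1 - r) + 2 * (r - 1) = D.edgeFinset.card * (k - 2) := by
  have hcard : Fintype.card (Fin k) = k := Fintype.card_fin k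
  obtain ⟨h1, D, inst, hK, hE, hS⟩ := cherry_third_best k a r ha3 hr3 hk hk3
  refine ⟨?_, D, inst, hK, hE, ?_⟩
  · intro D _ hK hm hne1 hne2
    have hne1' : ∑ v, deg D v * deg D v + r * (k - 1 - r) ≠ D.edgeFinset.card * k := by
      intro heq
      apply hne1
      have := (sum_deg_sq_eq_iff_cherries D (r * (k - 1 - r)) (by rw [hcard]; omega)).mp
        (by rw [hcard]; exact heq)
      rw [hcard] at this
      exact this
    have hne2' : ∑ v, deg D v * deg D v + r * (k - 1 - r) + 2 * (r - 2) ≠ D.edgeFinset.card * k := by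
      intro heq
      apply hne2
      have := (sum_deg_sq_eq_iff_cherries D (r * (k - 1 - r) + 2 * (r - 2)) (by rw [hcard]; omega)).mp
        (by rw [hcard]; rw [← add_assoc]; exact heq)
      rw [hcard] at this
      rw [add_assoc]
      exact this
    have h := h1 D hK hm hne1' hne2'
    have := (sum_deg_sq_le_iff_cherries D (r * (k - 1 - r) + 2 * (r - 1)) (by rw [hcard]; omega)).mp
      (by rw [hcard]; rw [← add_assoc]; exact h)
    rw [hcard] at this
    rw [add_assoc]
    exact this
  · have := (sum_deg_sq_eq_iff_cherries D (r * (k - 1 - r) + 2 * (r - 1)) (by rw [hcard]; omega)).mp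
      (by rw [hcard]; rw [← add_assoc]; exact hS)
    rw [hcard] at this
    rw [add_assoc]
    exact this

end C047

end TriangleCap

end PercRepro
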